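import Literature.MathematicalPhysics.QuantumFieldTheory.Balaban1983to89.B14Eq16Proof
import Literature.MathematicalPhysics.QuantumFieldTheory.Balaban1983to89.B14Sect3Decomp

/-!
# `Balaban1983to89.B14Eq111Resummation` — CMP 119 (1.11) p. 248, the RESUMMATION over `P₀, P₁, Q₁` at fixed `Ω₁`
# («as in (8) [16]»), PROVED: the first-step density after (1.6)·(1.8) regrouped fibre by fibre of the (1.10) rule
# `(P₀, P₁, Q₁) ↦ Ω₁`, with `ζ(Ω₁ᶜ)` DEFINED as the fibre sum of the `Ω₁ᶜ`-localized factors; (1.11) in the push-forward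
# reading of `∫dU δ(ŪV⁻¹)` (from p28's (1.6) `B14Eq16Proof.isRT_eq16`) and pointwise in `V` for every linear `T`

statement-level skeleton of published theorems with citation tags; proofs where landed; nothing here is a claim about the Yang–Mills mass gap

CITATION HEADER (lean-in-tree rule).  Source: T. Bałaban, *Convergent renormalization expansions for lattice gauge
theories*, Commun. Math. Phys. **119**, 243–285 (1988), doi:10.1007/bf01217741 [Balaban1988Convergent] (cell paper
B14 = «[III]»; held `paper:balaban1988-cmp119-convergent-renormalization`, journal page = PDF page + 242; p. 248 read on
the text layer `p0006` and the x2 render `…-p006-x2.png`).  Mega-formalization `lit-balaban`, unit `lit-balaban-r11`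
(CMP 119, B14 fold owner), SKELETON row **B14.Eq1.11** (inputs: rows B14.Eq1.6 = (1.6), B14.Eq1.8 = (1.8), B14.Eq1.10 =
(1.10) and its p. 248 sentence, B10.Eq8 = (8) [16]).

THE PRINTED TEXT (p. 248 [PDF 6], verbatim).  *"We take Q₁′ again as the union of LMR₁-cubes which intersect Q₁, and we
surround the sets Q₁′, (B(P₁¹)ᶜ)^∼ by two layers of LMR₁-cubes. Denote Ω₁ = (Q₁′^{∼2}∪(B(P₁¹)ᶜ)^{∼3})ᶜ =
(Q₁′^{∼2})ᶜ∩(B(P₁¹))^{∼−3}, (1.10) thus Ω₁ is a union of LMR₁-cubes, and a distance between Ω₁ and the union of the large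
field regions is at least 2LMR₁. On the set Ω₁^∼ we have only the small field characteristic functions, and it is easy to
see that the functions χ₀, χ_{Ax} localized in Ω₁^∼ are equal to 1, if A₀ is sufficiently larger than A₁. We drop these
functions from the integrals in (1.6).  We fix Ω₁ and we do the resummation with respect to P₀, P₁, Q₁, as in (8) [16].
This yields the equality
  ρ₁(V) = Σ_{Ω₁} χ₁(Ω₁) ∫dU δ(ŪV⁻¹) ζ(Ω₁ᶜ) χ′₀(Ω₁) · exp[−(1/g₀²) 𝐆(Ω₁^{(1)}, U) − (1/g₀²) A(U) − (L⁴−1)|Ω₁^{(1)}| log z − E].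
  (1.11)
Here the factor ζ(Ω₁ᶜ) is defined by all characteristic functions and gauge fixing exponential factors localized in Ω₁ᶜ,
and resummed over all admissible P₀, P₁, Q₁."*

THE CARRIER (pre-existing, knitted BY NAME).  r11 gen 2's `B14.Sect1Repr.Sect1Data D` = the Sect. 1 data on top of
`Setup`: the LM₂R₀-cubes `□` (`D.Cube0`) and the L²M₂R₁-cubes `□′` (`D.Cube1`) of `T₁` with their plaquette sets, the cubes
`□′ ⊂ (P₀′^∼)ᶜ` (`D.inCompl P₀`), `P₁¹` (`D.P11 P₀ P₁`), the contour variables (`D.cd`), and (1.2) `U_{1,□′}(V)` (`U1loc D`);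
on it (1.1)/(1.4)/(1.6) are `chi0`, `chi0c`, `chi1`, `chi1c`, `chiAx`, `integrand16`, `rho1Rhs`, `Eq16`, and (1.6) is PROVED by
p28 (`B14Eq16Proof.isRT_eq16`, `eq16`).  (1.8)'s `χ′₀`, `χ′₀ᶜ` are gen 2's (3.3) functions `B14.Sect3Decomp.chiPrime`/`chiPrimec`
at `k = 0` on the step-0 Sect. 3 data `sect3Zero D (□′ ↦ (□′^{∼2})*)` built from `D` (§1: `V₀ = U`, `V^{(0)}_{□′} = U_{1,□′}(V)`).
Since (1.10)'s `Ω₁` is a union of LMR₁-cubes and the partitions are compatible (p. 245; `LM₂R₀ ∣ L²M₂R₁ ∣ LMR₁`), `Ω₁` is a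
union of `□′`-cubes and of `□`-cubes: it is carried as the finite family `Ω₁ : Finset D.Cube1` of its `□′`-cubes — the
family over which (1.4)'s `χ₁(Ω₁)` and (1.8)'s `χ′₀(Ω₁)` are the printed products.

THE DATA OF (1.8)–(1.11) (`Geom D`, print's cube geometry entering as parameters, exactly as `inCompl`/`P11` enter
`Sect1Data`): `bondsStar □′ = (□′^{∼2})*` of (1.9); `domQ P₀ P₁` = the `□′`-cubes of `(B(P₁¹))^{∼−1}` (the range of `Q₁` in
(1.8)); `omega P₀ P₁ Q₁` = the `□′`-cubes of (1.10)'s `Ω₁`; `sites1 Ω₁ = Ω₁^{(1)}`; `encl0 Ω₁` = the `□`-cubes of `Ω₁^∼` and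
`encl1 Ω₁ = (Ω₁^∼)^{(1)}` (where the dropped `χ₀`, `χ_{Ax}` live).  THE PRINTED CONSEQUENCES OF (1.10) used by the
resummation are the HYPOTHESES `Geom.Adm110` (for admissible `(P₀, P₁, Q₁)`): `Ω₁ ⊂ P₁ᶜ = (P₀′^∼)ᶜ∖P₁` and `Ω₁ ⊂ Q₁ᶜ =
(B(P₁¹))^{∼−1}∖Q₁` as cube families, `Ω₁^{(1)} ⊂ P₁¹`, the `□`-cubes of `Ω₁^∼` lie in `P₀ᶜ`, `(Ω₁^∼)^{(1)} ⊂ P₁¹` — all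
immediate from `Ω₁^∼ ⊂ (Q₁′^∼)ᶜ ∩ B(P₁¹)^{∼−2}` (pv02's set-level `B14Sect1Sets.enl_omega1_subset`, row B14.Eq1.10) and
`B(P₁¹) ⊂ (P₀′^∼)ᶜ ∩ (P₁′^{∼2})ᶜ` (p. 246); they are stated on the abstract cube-index carrier, not re-derived.  THE p. 248
SENTENCE *"the functions χ₀, χ_{Ax} localized in Ω₁^∼ are equal to 1, if A₀ is sufficiently larger than A₁"* is the
HYPOTHESIS `hdrop` (an analytic in-text claim of print — row B14.Eq1.10, cell GAPS G-adv5-7 —, NOT proved here): on the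
support of the small-field functions `χ₁(P₁ᶜ)(V) χ′₀(Q₁ᶜ)(U, V)` the product `χ₀(encl0 Ω₁)(U) χ_{Ax}(encl1 Ω₁)(U)` equals `1`.

WHAT IS PROVED (no `Prop`-valued `def`; the (1.10) inclusions are the hypothesis structure `Geom.Adm110`; no `sorry`).
§1  `sect3Zero`, `vbox_sect3Zero` (`V^{(0)}_{□′} = U_{1,□′}(V)`), `smallApproxFluct_sect3Zero_iff` (the (1.8) cube condition
    verbatim: `sup_{b∈(□′^{∼2})*}|U(b)U_{1,□′}(V)(b)⁻¹ − 1| < 2δ₀`), `eq18_zero` ((1.8) on the Sect. 1 carrier, = gen 2's `eq33`).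
§2  `Tri D` (the labels `σ = (P₀, P₁, Q₁)`), `adm D X` (the admissible triples: `P₁ ⊂ (P₀′^∼)ᶜ`, `Q₁ ⊂ (B(P₁¹))^{∼−1}`),
    `sum_adm` (the triple sum of (1.6)·(1.8) IS the sum over `adm`), `admOmega` (the admissible `Ω₁` = the image of the
    (1.10) rule), `Geom.Adm110`.
§3  The factors, WITH BODIES: `term σ` (the term of (1.6)·(1.8) labelled `σ`), `front Ω₁` (`χ′₀(Ω₁)·exp[−(1/g₀²)𝐆(Ω₁^{(1)},U)
    − (1/g₀²)A(U) − (L⁴−1)|Ω₁^{(1)}| log z − E]`), `zetaTerm σ` (the `Ω₁ᶜ`-localized characteristic functions and gauge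
    fixing exponential factors of the term `σ`), **`zeta Ω₁ = ζ(Ω₁ᶜ) := Σ_{σ admissible, Ω₁(σ) = Ω₁} zetaTerm σ`** («resummed
    over all admissible P₀, P₁, Q₁»), `dropped Ω₁ = χ₀(encl0 Ω₁)χ_{Ax}(encl1 Ω₁)`; the splitting lemmas `chi1_split`, …,
    `exp16_split`; `term_eq_dropped_mul` (pure algebra: `term σ = dropped · χ₁(Ω₁)·(ζ-term σ · front Ω₁)`) and `term_eq`
    (under `hdrop`: `term σ = χ₁(Ω₁)(V) · (zetaTerm σ · front Ω₁)(U,V)`).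
§4  **`resum`** — the resummation «as in (8) [16]» (`Finset.sum_image'` over the fibres of the (1.10) rule, the mechanism of
    r07's B10 (8) `B10Decomposition7.resummation8_eq_sum7`): `Σ_{σ∈adm} term σ (U,V) = Σ_{Ω₁∈admOmega} χ₁(Ω₁)(V)·(ζ(Ω₁ᶜ)·front
    Ω₁)(U,V)`; `sum16_mul18` ((1.8) inserted in (1.6)'s double sum gives `Σ_{σ∈adm} term σ`).
§5  **(1.11)**: `isRT_eq111` — for the δ-function transformation of (0.1) in the cell's push-forward reading `Setup.IsRT`
    (DIVERGENCE F7; the reading in which row B14.Eq1.6 leads, lead word Q-B14-97-3): if `ρ₁` is the renormalization image of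
    `ρ₀` then `ρ₁` is the renormalization image of `U ↦ Σ_{Ω₁} χ₁(Ω₁)(Ū) ζ(Ω₁ᶜ)(U,Ū) χ′₀(Ω₁)(U,Ū) exp[−(1/g₀²)𝐆(Ω₁^{(1)},U) −
    (1/g₀²)A(U) − (L⁴−1)|Ω₁^{(1)}| log z − E]` (hypotheses = those of `isRT_eq16` + `Adm110` + `hdrop`); `eq111_of_eq16` —
    POINTWISE in `V` for every operator `T` linear over finite sums at the evaluation point (as the integral (0.1) and the
    kernel operators (0.13) [I] are): (1.6) `Eq16 D T …` ⟹ `(Tρ₀)(V) = Σ_{Ω₁} χ₁(Ω₁)(V) · T[U ↦ ζ(Ω₁ᶜ)(U,V) χ′₀(Ω₁)(U,V)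
    exp[…]](V)`, which is (1.11) with `∫dU δ(ŪV⁻¹)(·) = T[·](V)`.

NOT ASSERTED: the p. 248 drop sentence (hypothesis `hdrop`), the (1.10) geometry (hypotheses `Adm110` on the data), (1.6)
itself (p28's theorem is USED), anything about `U₁(Ω₁, V)` of (1.12) or the expansion after (1.11).

## References
* [Balaban1988Convergent] T. Bałaban, Commun. Math. Phys. 119 (1988) 243–285, (1.6)–(1.11) pp. 247–248.
* [Balaban1985UV3] T. Bałaban, Commun. Math. Phys. 102 (1985) 255–275, (8) p. 258 ([16]: the resummation).
-/

noncomputable section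

namespace Literature.MathematicalPhysics.QuantumFieldTheory.Balaban1983to89.B14.Eq111Resummation

open Literature.MathematicalPhysics.QuantumFieldTheory.Balaban1983to89
open B14.Sect1Repr B14.Sect3Decomp
open scoped BigOperators

variable {P : Params} {G : Type*} [GaugeGroup G]

/-! ## §1  (1.8) at the first step, on the Sect. 1 carrier -/

/-- The step-0 Sect. 3 data BUILT FROM the Sect. 1 data `D`: cubes `□′ = D.Cube1` with their plaquette sets, the starred
bond sets `(□′^{∼2})*` of (1.9) (`bS`), and the localized background `U_{1,□′}(V)` of (1.2) (`U1loc D`) in the slot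
`U_{k+1,□′}` at `k = 0`; `inB := id` (at the first step the range `(B(P₁¹))^{∼−1}` of `Q₁` depends on `P₀` and `P₁` and is
passed explicitly, see `Geom.domQ`); `abbrev`, so that its cube type is `D.Cube1` up to reducible unfolding.  On it gen 2's
(3.3) functions at `k = 0` ARE (1.8)'s `χ′₀`, `χ′₀ᶜ` (`V₀ = U`).
[cite: Balaban1988Convergent, (1.8) p.247, (3.3) p.265] -/
abbrev sect3Zero (D : Sect1Data P G) (bS : D.Cube1 → Finset (PBond P 0)) : Sect3Data P G 0 where
  Cube1 := D.Cube1
  plaqT := D.plaqT1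
  bondsStar := bS
  inB := id
  UkLoc := fun c (V : GaugeField P 1 G) => U1loc D c V

/-- (3.4) at `k = 0`: `V^{(0)}_{□′} = M⁰(U_{1,□′}(V)) = U_{1,□′}(V)` (definitional). [cite: Balaban1988Convergent, (1.8) p.247, (3.4) p.265] -/
theorem vbox_sect3Zero (D : Sect1Data P G) (bS : D.Cube1 → Finset (PBond P 0)) (av : ∀ j, Averaging P j G)
    (c : D.Cube1) (V : GaugeField P 1 G) : Vbox (sect3Zero D bS) av c V = U1loc D c V := rfl

/-- The cube condition of (1.8), verbatim: `sup_{b∈(□′^{∼2})*}|U(b)U⁻¹_{1,□′}(b) − 1| < 2δ₀` (`dist1 = |· − 1|`).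
[cite: Balaban1988Convergent, (1.8) p.247] -/
theorem smallApproxFluct_sect3Zero_iff (D : Sect1Data P G) (bS : D.Cube1 → Finset (PBond P 0))
    (av : ∀ j, Averaging P j G) (twoδ : ℝ) (U : GaugeField P 0 G) (V : GaugeField P 1 G) (c : D.Cube1) :
    SmallApproxFluct (sect3Zero D bS) av twoδ U V c ↔ ∀ b ∈ bS c, dist1 (U b * (U1loc D c V b)⁻¹) < twoδ :=
  Iff.rfl

/-- **(1.8)** p. 247 on the Sect. 1 carrier: `Σ_{Q₁⊂dom} χ′₀(dom∖Q₁)(U,V) χ′₀ᶜ(Q₁)(U,V) = 1` for every cube family `dom` (print: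
`dom` = the `□′`-cubes of `(B(P₁¹))^{∼−1}`) — gen 2's (3.3) theorem `eq33` at `k = 0`. [cite: Balaban1988Convergent, (1.8) p.247] -/
theorem eq18_zero (D : Sect1Data P G) (bS : D.Cube1 → Finset (PBond P 0)) (av : ∀ j, Averaging P j G) (twoδ : ℝ)
    (dom : Finset D.Cube1) (U : GaugeField P 0 G) (V : GaugeField P 1 G) :
    ∑ Q1 ∈ dom.powerset, chiPrime (sect3Zero D bS) av twoδ (dom \ Q1) U V *
      chiPrimec (sect3Zero D bS) av twoδ Q1 U V = 1 :=
  eq33 (sect3Zero D bS) av twoδ dom U V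

/-! ## §2  The labels `(P₀, P₁, Q₁)`, the admissible triples, and the data of (1.8)–(1.11) -/

/-- The labels `σ = (P₀, P₁, Q₁)` of the terms of (1.6)·(1.8): `P₀` a family of LM₂R₀-cubes, `P₁`, `Q₁` families of
L²M₂R₁-cubes (`σ.1 = P₀`, `σ.2.1 = P₁`, `σ.2.2 = Q₁`). [cite: Balaban1988Convergent, (1.6)–(1.8) p.247] -/
abbrev Tri (D : Sect1Data P G) : Type := Σ _ : Finset D.Cube0, Σ _ : Finset D.Cube1, Finset D.Cube1

/-- The geometric data of (1.8)–(1.11) on top of the Sect. 1 data (print's cube geometry, entering as parameters):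
`bondsStar □′ = (□′^{∼2})*` (1.9); `domQ P₀ P₁` = the `□′`-cubes of `(B(P₁¹))^{∼−1}`, the range of `Q₁` in (1.8); `omega P₀ P₁ Q₁`
= the `□′`-cubes of `Ω₁ = (Q₁′^{∼2})ᶜ∩(B(P₁¹))^{∼−3}` (1.10); `sites1 Ω₁ = Ω₁^{(1)} ⊂ T^{(1)}`; `encl0 Ω₁` = the `□`-cubes of
`Ω₁^∼`; `encl1 Ω₁ = (Ω₁^∼)^{(1)}`. [cite: Balaban1988Convergent, (1.8)–(1.10) pp.247–248] -/
structure Geom (D : Sect1Data P G) where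
  bondsStar : D.Cube1 → Finset (PBond P 0)
  domQ : Finset D.Cube0 → Finset D.Cube1 → Finset D.Cube1
  omega : Finset D.Cube0 → Finset D.Cube1 → Finset D.Cube1 → Finset D.Cube1
  sites1 : Finset D.Cube1 → Finset (Site P 1)
  encl0 : Finset D.Cube1 → Finset D.Cube0
  encl1 : Finset D.Cube1 → Finset (Site P 1)

section Data

variable (D : Sect1Data P G) (X : Geom D)

/-- The admissible `(P₀, P₁, Q₁)` of (1.6)·(1.8): `P₀` any family of LM₂R₀-cubes, `P₁ ⊂ (P₀′^∼)ᶜ` (1.4), `Q₁ ⊂ (B(P₁¹))^{∼−1}`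
(1.8). [cite: Balaban1988Convergent, (1.4) p.246, (1.8) p.247] -/
def adm : Finset (Tri D) :=
  (Finset.univ : Finset D.Cube0).powerset.sigma fun P0 =>
    ((D.inCompl P0).powerset).sigma fun P1 => (X.domQ P0 P1).powerset

/-- Membership in `adm`. [cite: Balaban1988Convergent, (1.4) p.246, (1.8) p.247] -/
theorem mem_adm {σ : Tri D} : σ ∈ adm D X ↔ σ.2.1 ⊆ D.inCompl σ.1 ∧ σ.2.2 ⊆ X.domQ σ.1 σ.2.1 := by
  simp [adm, Finset.mem_sigma]

/-- The triple sum `Σ_{P₀} Σ_{P₁⊂(P₀′^∼)ᶜ} Σ_{Q₁⊂(B(P₁¹))^{∼−1}}` of (1.6)·(1.8) is the sum over the admissible triples.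
[cite: Balaban1988Convergent, (1.6)–(1.8) p.247] -/
theorem sum_adm (f : Tri D → ℝ) :
    ∑ σ ∈ adm D X, f σ = ∑ P0 ∈ (Finset.univ : Finset D.Cube0).powerset, ∑ P1 ∈ (D.inCompl P0).powerset,
      ∑ Q1 ∈ (X.domQ P0 P1).powerset, f ⟨P0, P1, Q1⟩ := by
  unfold adm
  rw [Finset.sum_sigma]
  exact Finset.sum_congr rfl fun P0 _ => Finset.sum_sigma _ _ _

/-- `Ω₁(σ)` — the (1.10) rule applied to the label `σ = (P₀, P₁, Q₁)`. [cite: Balaban1988Convergent, (1.10) p.248] -/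
def omegaOf (σ : Tri D) : Finset D.Cube1 := X.omega σ.1 σ.2.1 σ.2.2

/-- The admissible `Ω₁` of (1.11) (the range of `Σ_{Ω₁}`): the image of the admissible `(P₀, P₁, Q₁)` under the (1.10) rule.
[cite: Balaban1988Convergent, (1.10)–(1.11) p.248] -/
def admOmega : Finset (Finset D.Cube1) := (adm D X).image (omegaOf D X)

/-- `Ω₁` is admissible iff it is `Ω₁(P₀, P₁, Q₁)` for some admissible triple. [cite: Balaban1988Convergent, (1.10)–(1.11) p.248] -/
theorem mem_admOmega {Ω : Finset D.Cube1} : Ω ∈ admOmega D X ↔ ∃ σ ∈ adm D X, omegaOf D X σ = Ω :=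
  Finset.mem_image

/-- THE PRINTED CONSEQUENCES OF (1.10) used by the resummation, as hypotheses on the data (for admissible `σ = (P₀, P₁, Q₁)`,
`Ω₁ = Ω₁(σ)`): `Ω₁`'s `□′`-cubes are small-field cubes of (1.4) (`⊂ (P₀′^∼)ᶜ∖P₁`) and of (1.8) (`⊂ (B(P₁¹))^{∼−1}∖Q₁`),
`Ω₁^{(1)} ⊂ P₁¹`, the `□`-cubes of `Ω₁^∼` are small-field cubes of (1.1) (`⊂ P₀ᶜ`), `(Ω₁^∼)^{(1)} ⊂ P₁¹` — p. 248: *"Ω₁ = (Q₁′^{∼2})ᶜ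
∩(B(P₁¹))^{∼−3} … On the set Ω₁^∼ we have only the small field characteristic functions"* (set level: row B14.Eq1.10,
`B14Sect1Sets.enl_omega1_subset`), with `B(P₁¹) ⊂ (P₀′^∼)ᶜ∩(P₁′^{∼2})ᶜ` (p. 246). [cite: Balaban1988Convergent, (1.10) p.248] -/
structure Geom.Adm110 : Prop where
  omega_subset_small1 : ∀ σ ∈ adm D X, omegaOf D X σ ⊆ D.inCompl σ.1 \ σ.2.1
  omega_subset_smallQ : ∀ σ ∈ adm D X, omegaOf D X σ ⊆ X.domQ σ.1 σ.2.1 \ σ.2.2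
  sites1_subset : ∀ σ ∈ adm D X, X.sites1 (omegaOf D X σ) ⊆ D.P11 σ.1 σ.2.1
  encl0_subset : ∀ σ ∈ adm D X, X.encl0 (omegaOf D X σ) ⊆ Finset.univ \ σ.1
  encl1_subset : ∀ σ ∈ adm D X, X.encl1 (omegaOf D X σ) ⊆ D.P11 σ.1 σ.2.1

end Data

/-! ## §3  The factors of (1.11), WITH BODIES -/

section Factors

variable (D : Sect1Data P G) (X : Geom D) (av : ∀ j, Averaging P j G)

/-- The term of (1.6)·(1.8) labelled `σ = (P₀, P₁, Q₁)`, at `(U, V)`: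
`χ₁ᶜ(P₁)(V) χ₁(P₁ᶜ)(V) · χ′₀(Q₁ᶜ)(U,V) χ′₀ᶜ(Q₁)(U,V) · χ₀ᶜ(P₀)χ₀(P₀ᶜ)χ_{Ax}(P₁¹) exp[−(1/g₀²)𝐆(P₁¹,U) − (1/g₀²)A(U) − (L⁴−1)|P₁¹| log z
− E]` (`P₁ᶜ = (P₀′^∼)ᶜ∖P₁`, `Q₁ᶜ = (B(P₁¹))^{∼−1}∖Q₁`; the last group is gen 2's `integrand16`).
[cite: Balaban1988Convergent, (1.6)–(1.8) p.247] -/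
def term (g₀ ε₀ ε₁ twoδ z E : ℝ) (σ : Tri D) (U : GaugeField P 0 G) (V : GaugeField P 1 G) : ℝ :=
  chi1c D ε₁ σ.2.1 V * chi1 D ε₁ (D.inCompl σ.1 \ σ.2.1) V *
    (chiPrime (sect3Zero D X.bondsStar) av twoδ (X.domQ σ.1 σ.2.1 \ σ.2.2) U V *
      chiPrimec (sect3Zero D X.bondsStar) av twoδ σ.2.2 U V *
      integrand16 D g₀ ε₀ z E σ.1 σ.2.1 U)

/-- The `Ω₁`-localized factor kept in front of (1.11) under the integral:
`χ′₀(Ω₁)(U,V) · exp[−(1/g₀²) 𝐆(Ω₁^{(1)}, U) − (1/g₀²) A(U) − (L⁴−1)|Ω₁^{(1)}| log z − E]` (`𝐆` = `Setup.gaugeFixFn` (1.7), `A` =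
`Setup.wilsonAction4`, `L⁴ − 1` as printed). [cite: Balaban1988Convergent, (1.11) p.248] -/
def front (g₀ twoδ z E : ℝ) (Ω : Finset D.Cube1) (U : GaugeField P 0 G) (V : GaugeField P 1 G) : ℝ :=
  chiPrime (sect3Zero D X.bondsStar) av twoδ Ω U V *
    Real.exp (-(1 / g₀ ^ 2) * gaugeFixFn D.cd (X.sites1 Ω) U - (1 / g₀ ^ 2) * wilsonAction4 U
      - ((P.L : ℝ) ^ 4 - 1) * ((X.sites1 Ω).card : ℝ) * Real.log z - E)

/-- The `Ω₁ᶜ`-localized factors of the term labelled `σ = (P₀, P₁, Q₁)` (`Ω₁ = Ω₁(σ)`): *"all characteristic functions and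
gauge fixing exponential factors localized in Ω₁ᶜ"* — `χ₁ᶜ(P₁) χ₁(P₁ᶜ∖Ω₁) · χ′₀(Q₁ᶜ∖Ω₁) χ′₀ᶜ(Q₁) · χ₀ᶜ(P₀) χ₀(P₀ᶜ∖□(Ω₁^∼))
χ_{Ax}(P₁¹∖(Ω₁^∼)^{(1)}) exp[−(1/g₀²)𝐆(P₁¹∖Ω₁^{(1)},U) − (L⁴−1)|P₁¹∖Ω₁^{(1)}| log z]` (the `χ₀`, `χ_{Ax}` localized in `Ω₁^∼`
being dropped, p. 248). [cite: Balaban1988Convergent, (1.11) p.248] -/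
def zetaTerm (g₀ ε₀ ε₁ twoδ z : ℝ) (σ : Tri D) (U : GaugeField P 0 G) (V : GaugeField P 1 G) : ℝ :=
  chi1c D ε₁ σ.2.1 V * chi1 D ε₁ ((D.inCompl σ.1 \ σ.2.1) \ omegaOf D X σ) V *
    (chiPrime (sect3Zero D X.bondsStar) av twoδ ((X.domQ σ.1 σ.2.1 \ σ.2.2) \ omegaOf D X σ) U V *
      chiPrimec (sect3Zero D X.bondsStar) av twoδ σ.2.2 U V) *
    (chi0c D ε₀ σ.1 U * chi0 D ε₀ ((Finset.univ \ σ.1) \ X.encl0 (omegaOf D X σ)) U *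
      chiAx D ε₀ (D.P11 σ.1 σ.2.1 \ X.encl1 (omegaOf D X σ)) U *
      Real.exp (-(1 / g₀ ^ 2) * gaugeFixFn D.cd (D.P11 σ.1 σ.2.1 \ X.sites1 (omegaOf D X σ)) U
        - ((P.L : ℝ) ^ 4 - 1) * ((D.P11 σ.1 σ.2.1 \ X.sites1 (omegaOf D X σ)).card : ℝ) * Real.log z))

/-- **`ζ(Ω₁ᶜ)`** of (1.11), DEFINED: the `Ω₁ᶜ`-localized factors *"resummed over all admissible P₀, P₁, Q₁"* — the sum of
`zetaTerm σ` over the admissible `σ` with `Ω₁(σ) = Ω₁` (the fibre of the (1.10) rule). [cite: Balaban1988Convergent, (1.11) p.248] -/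
def zeta (g₀ ε₀ ε₁ twoδ z : ℝ) (Ω : Finset D.Cube1) (U : GaugeField P 0 G) (V : GaugeField P 1 G) : ℝ :=
  ∑ σ ∈ (adm D X).filter (fun σ => omegaOf D X σ = Ω), zetaTerm D X av g₀ ε₀ ε₁ twoδ z σ U V

/-- Unfolding of `ζ(Ω₁ᶜ)`. [cite: Balaban1988Convergent, (1.11) p.248] -/
theorem zeta_eq (g₀ ε₀ ε₁ twoδ z : ℝ) (Ω : Finset D.Cube1) (U : GaugeField P 0 G) (V : GaugeField P 1 G) :
    zeta D X av g₀ ε₀ ε₁ twoδ z Ω U V =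
      ∑ σ ∈ (adm D X).filter (fun σ => omegaOf D X σ = Ω), zetaTerm D X av g₀ ε₀ ε₁ twoδ z σ U V := rfl

/-- The dropped factor of p. 248: `χ₀` on the `□`-cubes of `Ω₁^∼` times `χ_{Ax}` on `(Ω₁^∼)^{(1)}` — *"the functions χ₀, χ_{Ax}
localized in Ω₁^∼"*. [cite: Balaban1988Convergent, (1.10) p.248] -/
def dropped (ε₀ : ℝ) (Ω : Finset D.Cube1) (U : GaugeField P 0 G) : ℝ :=
  chi0 D ε₀ (X.encl0 Ω) U * chiAx D ε₀ (X.encl1 Ω) U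

/-! ### Splitting the products and sums over a sub-family -/

omit X av in
/-- `χ₁(S) = χ₁(Ω)χ₁(S∖Ω)` for `Ω ⊂ S` (product over cubes). [cite: Balaban1988Convergent, (1.4) p.246] -/
theorem chi1_split {S Ω : Finset D.Cube1} (h : Ω ⊆ S) (ε₁ : ℝ) (V : GaugeField P 1 G) :
    chi1 D ε₁ S V = chi1 D ε₁ Ω V * chi1 D ε₁ (S \ Ω) V := by
  simp only [chi1]
  rw [← Finset.prod_sdiff h, mul_comm]

omit X av in
/-- `χ₀(S) = χ₀(Ω)χ₀(S∖Ω)` for `Ω ⊂ S`. [cite: Balaban1988Convergent, (1.1) p.246] -/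
theorem chi0_split {S Ω : Finset D.Cube0} (h : Ω ⊆ S) (ε₀ : ℝ) (U : GaugeField P 0 G) :
    chi0 D ε₀ S U = chi0 D ε₀ Ω U * chi0 D ε₀ (S \ Ω) U := by
  simp only [chi0]
  rw [← Finset.prod_sdiff h, mul_comm]

omit X av in
/-- `χ_{Ax}(Y) = χ_{Ax}(Y₁)χ_{Ax}(Y∖Y₁)` for `Y₁ ⊂ Y` (product over the block centres `y`). [cite: Balaban1988Convergent, (1.5)–(1.6) p.247] -/
theorem chiAx_split {Y Y₁ : Finset (Site P 1)} (h : Y₁ ⊆ Y) (ε₀ : ℝ) (U : GaugeField P 0 G) :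
    chiAx D ε₀ Y U = chiAx D ε₀ Y₁ U * chiAx D ε₀ (Y \ Y₁) U := by
  simp only [chiAx]
  rw [← Finset.prod_sdiff h, mul_comm]

omit av in
/-- `χ′₀(S) = χ′₀(Ω)χ′₀(S∖Ω)` for `Ω ⊂ S`. [cite: Balaban1988Convergent, (1.8) p.247] -/
theorem chiPrime_split (av : ∀ j, Averaging P j G) {S Ω : Finset D.Cube1} (h : Ω ⊆ S) (twoδ : ℝ)
    (U : GaugeField P 0 G) (V : GaugeField P 1 G) :
    chiPrime (sect3Zero D X.bondsStar) av twoδ S U V =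
      chiPrime (sect3Zero D X.bondsStar) av twoδ Ω U V * chiPrime (sect3Zero D X.bondsStar) av twoδ (S \ Ω) U V := by
  simp only [chiPrime]
  rw [← Finset.prod_sdiff h, mul_comm]

omit X av in
/-- `𝐆(Y, U) = 𝐆(Y₁, U) + 𝐆(Y∖Y₁, U)` for `Y₁ ⊂ Y` ((1.7) is a sum over `y ∈ Y`). [cite: Balaban1988Convergent, (1.7) p.247] -/
theorem gaugeFixFn_split {Y Y₁ : Finset (Site P 1)} (h : Y₁ ⊆ Y) (U : GaugeField P 0 G) :
    gaugeFixFn D.cd Y U = gaugeFixFn D.cd Y₁ U + gaugeFixFn D.cd (Y \ Y₁) U := by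
  simp only [gaugeFixFn]
  rw [← Finset.sum_sdiff h, add_comm]

omit D in
/-- `|Y| = |Y₁| + |Y∖Y₁|` for `Y₁ ⊂ Y`. [folklore] -/
private theorem card_split {Y Y₁ : Finset (Site P 1)} (h : Y₁ ⊆ Y) : (Y.card : ℝ) = (Y₁.card : ℝ) + ((Y \ Y₁).card : ℝ) := by
  rw [← Finset.card_sdiff_add_card_eq_card h]
  push_cast
  ring

omit X av in
/-- The exponential of (1.6) splits along `Ω₁^{(1)} ⊂ P₁¹`: `exp[−(1/g₀²)𝐆(P₁¹,U) − (1/g₀²)A(U) − (L⁴−1)|P₁¹| log z − E] =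
exp[−(1/g₀²)𝐆(Ω₁^{(1)},U) − (1/g₀²)A(U) − (L⁴−1)|Ω₁^{(1)}| log z − E] · exp[−(1/g₀²)𝐆(P₁¹∖Ω₁^{(1)},U) − (L⁴−1)|P₁¹∖Ω₁^{(1)}| log
z]`. [cite: Balaban1988Convergent, (1.6) p.247, (1.11) p.248] -/
theorem exp16_split {Y Y₁ : Finset (Site P 1)} (h : Y₁ ⊆ Y) (g₀ z E : ℝ) (U : GaugeField P 0 G) :
    Real.exp (-(1 / g₀ ^ 2) * gaugeFixFn D.cd Y U - (1 / g₀ ^ 2) * wilsonAction4 U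
        - ((P.L : ℝ) ^ 4 - 1) * (Y.card : ℝ) * Real.log z - E) =
      Real.exp (-(1 / g₀ ^ 2) * gaugeFixFn D.cd Y₁ U - (1 / g₀ ^ 2) * wilsonAction4 U
          - ((P.L : ℝ) ^ 4 - 1) * (Y₁.card : ℝ) * Real.log z - E) *
        Real.exp (-(1 / g₀ ^ 2) * gaugeFixFn D.cd (Y \ Y₁) U
          - ((P.L : ℝ) ^ 4 - 1) * ((Y \ Y₁).card : ℝ) * Real.log z) := by
  rw [← Real.exp_add, gaugeFixFn_split D h, card_split h]
  congr 1
  ring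

/-! ### The term of (1.6)·(1.8) factorizes along `Ω₁` -/

/-- PURE ALGEBRA of the regrouping: for an admissible `σ` with `Ω₁ = Ω₁(σ)` and the (1.10) inclusions, the term of
(1.6)·(1.8) labelled `σ` equals `[χ₀(□(Ω₁^∼))χ_{Ax}((Ω₁^∼)^{(1)})] · χ₁(Ω₁)(V) · (ζ-term(σ) · χ′₀(Ω₁) exp[…Ω₁^{(1)}…])(U,V)` — the
dropped factor times the (1.11) form. [cite: Balaban1988Convergent, (1.11) p.248] -/
theorem term_eq_dropped_mul (hX : X.Adm110 D) (g₀ ε₀ ε₁ twoδ z E : ℝ) {σ : Tri D} (hσ : σ ∈ adm D X)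
    (U : GaugeField P 0 G) (V : GaugeField P 1 G) :
    term D X av g₀ ε₀ ε₁ twoδ z E σ U V =
      dropped D X ε₀ (omegaOf D X σ) U *
        (chi1 D ε₁ (omegaOf D X σ) V *
          (zetaTerm D X av g₀ ε₀ ε₁ twoδ z σ U V * front D X av g₀ twoδ z E (omegaOf D X σ) U V)) := by
  simp only [term, dropped, zetaTerm, front, integrand16]
  rw [chi1_split D (hX.omega_subset_small1 σ hσ) ε₁ V,
    chiPrime_split D X av (hX.omega_subset_smallQ σ hσ) twoδ U V,
    chi0_split D (hX.encl0_subset σ hσ) ε₀ U, chiAx_split D (hX.encl1_subset σ hσ) ε₀ U,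
    exp16_split D (hX.sites1_subset σ hσ) g₀ z E U]
  ring

/-- For an admissible `σ` with `Ω₁ = Ω₁(σ)`, under the (1.10) inclusions and the p. 248 drop sentence (`hdrop`: on the support
of `χ₁(P₁ᶜ)(V) χ′₀(Q₁ᶜ)(U,V)` the functions `χ₀`, `χ_{Ax}` localized in `Ω₁^∼` equal `1`), the term of (1.6)·(1.8) labelled `σ` IS
`χ₁(Ω₁)(V) · ζ-term(σ)(U,V) · χ′₀(Ω₁)(U,V) exp[−(1/g₀²)𝐆(Ω₁^{(1)},U) − (1/g₀²)A(U) − (L⁴−1)|Ω₁^{(1)}| log z − E]`.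
[cite: Balaban1988Convergent, (1.11) p.248] -/
theorem term_eq (hX : X.Adm110 D) (g₀ ε₀ ε₁ twoδ z E : ℝ) {σ : Tri D} (hσ : σ ∈ adm D X)
    (U : GaugeField P 0 G) (V : GaugeField P 1 G)
    (hdrop : chi1 D ε₁ (D.inCompl σ.1 \ σ.2.1) V ≠ 0 →
      chiPrime (sect3Zero D X.bondsStar) av twoδ (X.domQ σ.1 σ.2.1 \ σ.2.2) U V ≠ 0 →
      dropped D X ε₀ (omegaOf D X σ) U = 1) :
    term D X av g₀ ε₀ ε₁ twoδ z E σ U V =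
      chi1 D ε₁ (omegaOf D X σ) V *
        (zetaTerm D X av g₀ ε₀ ε₁ twoδ z σ U V * front D X av g₀ twoδ z E (omegaOf D X σ) U V) := by
  by_cases h1 : chi1 D ε₁ (D.inCompl σ.1 \ σ.2.1) V = 0
  · -- a small-field function of (1.4) vanishes: both sides are `0`
    have h1' : chi1 D ε₁ (omegaOf D X σ) V * chi1 D ε₁ ((D.inCompl σ.1 \ σ.2.1) \ omegaOf D X σ) V = 0 := by
      rw [← chi1_split D (hX.omega_subset_small1 σ hσ)]; exact h1
    rcases mul_eq_zero.1 h1' with h | h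
    · simp only [term, h1, h, mul_zero, zero_mul]
    · simp only [term, zetaTerm, h1, h, mul_zero, zero_mul]
  by_cases h2 : chiPrime (sect3Zero D X.bondsStar) av twoδ (X.domQ σ.1 σ.2.1 \ σ.2.2) U V = 0
  · -- a small-field function of (1.8) vanishes: both sides are `0`
    have h2' : chiPrime (sect3Zero D X.bondsStar) av twoδ (omegaOf D X σ) U V *
        chiPrime (sect3Zero D X.bondsStar) av twoδ ((X.domQ σ.1 σ.2.1 \ σ.2.2) \ omegaOf D X σ) U V = 0 := by
      rw [← chiPrime_split D X av (hX.omega_subset_smallQ σ hσ)]; exact h2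
    rcases mul_eq_zero.1 h2' with h | h
    · simp only [term, front, h2, h, mul_zero, zero_mul]
    · simp only [term, zetaTerm, h2, h, mul_zero, zero_mul]
  rw [term_eq_dropped_mul D X av hX g₀ ε₀ ε₁ twoδ z E hσ U V, hdrop h1 h2, one_mul]

end Factors

/-! ## §4  The resummation «as in (8) [16]» -/

section Resummation

variable (D : Sect1Data P G) (X : Geom D) (av : ∀ j, Averaging P j G)

/-- **The resummation over `P₀, P₁, Q₁` at fixed `Ω₁`** (p. 248: *"We fix Ω₁ and we do the resummation with respect to P₀,
P₁, Q₁, as in (8) [16]"*): summing the terms of (1.6)·(1.8) fibre by fibre of the (1.10) rule `σ ↦ Ω₁(σ)` gives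
`Σ_{admissible Ω₁} χ₁(Ω₁)(V) · ζ(Ω₁ᶜ)(U,V) · χ′₀(Ω₁)(U,V) exp[−(1/g₀²)𝐆(Ω₁^{(1)},U) − (1/g₀²)A(U) − (L⁴−1)|Ω₁^{(1)}| log z − E]` — an
identity of finite sums (`Finset.sum_image'`; the mechanism of (8) [16], r07's `B10Decomposition7.resummation8_eq_sum7`), for
every `(U, V)`, under the (1.10) inclusions and the p. 248 drop sentence. [cite: Balaban1988Convergent, (1.11) p.248; Balaban1985UV3, (8) p.258] -/
theorem resum (hX : X.Adm110 D) (g₀ ε₀ ε₁ twoδ z E : ℝ) (U : GaugeField P 0 G) (V : GaugeField P 1 G)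
    (hdrop : ∀ σ ∈ adm D X, chi1 D ε₁ (D.inCompl σ.1 \ σ.2.1) V ≠ 0 →
      chiPrime (sect3Zero D X.bondsStar) av twoδ (X.domQ σ.1 σ.2.1 \ σ.2.2) U V ≠ 0 →
      dropped D X ε₀ (omegaOf D X σ) U = 1) :
    ∑ σ ∈ adm D X, term D X av g₀ ε₀ ε₁ twoδ z E σ U V =
      ∑ Ω ∈ admOmega D X, chi1 D ε₁ Ω V *
        (zeta D X av g₀ ε₀ ε₁ twoδ z Ω U V * front D X av g₀ twoδ z E Ω U V) := by
  unfold admOmega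
  symm
  refine Finset.sum_image' _ fun τ hτ => ?_
  rw [zeta_eq, Finset.sum_mul, Finset.mul_sum]
  refine Finset.sum_congr rfl fun σ hσ => ?_
  rw [Finset.mem_filter] at hσ
  rw [← hσ.2]
  exact (term_eq D X av hX g₀ ε₀ ε₁ twoδ z E hσ.1 U V (hdrop σ hσ.1)).symm

/-- (1.8) inserted in the double sum of (1.6): at every `(U, V)`,
`Σ_{P₀P₁} χ₁ᶜ(P₁)(V)χ₁(P₁ᶜ)(V) · [χ₀ᶜχ₀χ_{Ax} exp(…)](U) = Σ_{admissible (P₀,P₁,Q₁)} term(P₀,P₁,Q₁)(U,V)` (the integrand is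
multiplied by `1 = Σ_{Q₁} χ′₀(Q₁ᶜ)χ′₀ᶜ(Q₁)`, `eq18_zero`). [cite: Balaban1988Convergent, (1.6)–(1.8) p.247] -/
theorem sum16_mul18 (g₀ ε₀ ε₁ twoδ z E : ℝ) (U : GaugeField P 0 G) (V : GaugeField P 1 G) :
    ∑ P0 ∈ (Finset.univ : Finset D.Cube0).powerset, ∑ P1 ∈ (D.inCompl P0).powerset,
        chi1c D ε₁ P1 V * chi1 D ε₁ (D.inCompl P0 \ P1) V * integrand16 D g₀ ε₀ z E P0 P1 U =
      ∑ σ ∈ adm D X, term D X av g₀ ε₀ ε₁ twoδ z E σ U V := by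
  rw [sum_adm]
  refine Finset.sum_congr rfl fun P0 _ => Finset.sum_congr rfl fun P1 _ => ?_
  simp only [term]
  rw [← Finset.mul_sum]
  congr 1
  rw [← Finset.sum_mul, eq18_zero, one_mul]

end Resummation

/-! ## §5  (1.11) -/

section Eq111

variable {P : Params} {G : Type*} [GaugeGroup G]

/-- **(1.11) for every linear `T`, pointwise in `V`.**  Let `T` be an operator on densities that is linear over finite sums at
the evaluation point (`T[Σᵢ cᵢ ρᵢ](V) = Σᵢ cᵢ T[ρᵢ](V)` — as the integral `∫dU δ(ŪV⁻¹)(·)` of (0.1) and the kernel operators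
(0.13) [I] are), for which (1.6) holds (`B14.Sect1Repr.Eq16`, PROVED for the [I] (0.13) kernel class by p28's
`B14Eq16Proof.eq16`).  Then, under the (1.10) inclusions and the p. 248 drop sentence,
`ρ₁(V) = (Tρ₀)(V) = Σ_{Ω₁} χ₁(Ω₁)(V) · T[U ↦ ζ(Ω₁ᶜ)(U,V) χ′₀(Ω₁)(U,V) exp(−(1/g₀²)𝐆(Ω₁^{(1)},U) − (1/g₀²)A(U) − (L⁴−1)|Ω₁^{(1)}| log z
− E)](V)` — (1.11) with `∫dU δ(ŪV⁻¹)(·) = T[·](V)`. [cite: Balaban1988Convergent, (1.11) p.248] -/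
theorem eq111_of_eq16 (D : Sect1Data P G) (X : Geom D) (hX : X.Adm110 D) (av : ∀ j, Averaging P j G)
    (g₀ ε₀ ε₁ twoδ z E : ℝ) (T : Density P 0 G → Density P 1 G)
    (hT : ∀ (ι : Type) (s : Finset ι) (c : ι → ℝ) (ρ : ι → Density P 0 G) (V : GaugeField P 1 G),
      T (fun U => ∑ i ∈ s, c i * ρ i U) V = ∑ i ∈ s, c i * T (ρ i) V)
    (h16 : Eq16 D T g₀ ε₀ ε₁ z E) (V : GaugeField P 1 G)
    (hdrop : ∀ σ ∈ adm D X, ∀ U : GaugeField P 0 G, chi1 D ε₁ (D.inCompl σ.1 \ σ.2.1) V ≠ 0 →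
      chiPrime (sect3Zero D X.bondsStar) av twoδ (X.domQ σ.1 σ.2.1 \ σ.2.2) U V ≠ 0 →
      dropped D X ε₀ (omegaOf D X σ) U = 1) :
    T (rho0 g₀ E) V =
      ∑ Ω ∈ admOmega D X, chi1 D ε₁ Ω V *
        T (fun U => zeta D X av g₀ ε₀ ε₁ twoδ z Ω U V *
          (chiPrime (sect3Zero D X.bondsStar) av twoδ Ω U V *
            Real.exp (-(1 / g₀ ^ 2) * gaugeFixFn D.cd (X.sites1 Ω) U - (1 / g₀ ^ 2) * wilsonAction4 U
              - ((P.L : ℝ) ^ 4 - 1) * ((X.sites1 Ω).card : ℝ) * Real.log z - E))) V := by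
  -- the two consequences of linearity that are used
  have hTsum : ∀ (ι : Type) (s : Finset ι) (ρ : ι → Density P 0 G),
      T (fun U => ∑ i ∈ s, ρ i U) V = ∑ i ∈ s, T (ρ i) V := by
    intro ι s ρ
    have h := hT ι s (fun _ => 1) ρ V
    simpa only [one_mul] using h
  have hTmul : ∀ (a : ℝ) (ρ : Density P 0 G), T (fun U => a * ρ U) V = a * T ρ V := by
    intro a ρ
    have h := hT Unit {()} (fun _ => a) (fun _ => ρ) V
    simpa only [Finset.sum_singleton] using h
  -- the term of (1.6)·(1.8) under `T`, two ways
  have hterm : ∀ σ ∈ adm D X,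
      T (fun U => term D X av g₀ ε₀ ε₁ twoδ z E σ U V) V =
        chi1 D ε₁ (omegaOf D X σ) V *
          T (fun U => zetaTerm D X av g₀ ε₀ ε₁ twoδ z σ U V *
            front D X av g₀ twoδ z E (omegaOf D X σ) U V) V := by
    intro σ hσ
    rw [← hTmul]
    congr 1
    funext U
    exact term_eq D X av hX g₀ ε₀ ε₁ twoδ z E hσ U V (hdrop σ hσ U)
  -- left-hand side: (1.6), then (1.8) under `T`, then linearity
  have hL : T (rho0 g₀ E) V = ∑ σ ∈ adm D X, T (fun U => term D X av g₀ ε₀ ε₁ twoδ z E σ U V) V := by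
    rw [h16 V]
    simp only [rho1Rhs]
    rw [sum_adm]
    refine Finset.sum_congr rfl fun P0 _ => Finset.sum_congr rfl fun P1 _ => ?_
    have h18 : integrand16 D g₀ ε₀ z E P0 P1 = fun U => ∑ Q1 ∈ (X.domQ P0 P1).powerset,
        chiPrime (sect3Zero D X.bondsStar) av twoδ (X.domQ P0 P1 \ Q1) U V *
          chiPrimec (sect3Zero D X.bondsStar) av twoδ Q1 U V * integrand16 D g₀ ε₀ z E P0 P1 U := by
      funext U
      rw [← Finset.sum_mul, eq18_zero, one_mul]
    rw [h18, hTsum, Finset.mul_sum]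
    refine Finset.sum_congr rfl fun Q1 _ => ?_
    rw [← hTmul]
    simp only [term, mul_assoc]
  -- right-hand side: `ζ` is a fibre sum, linearity, and the fibrewise regrouping
  rw [hL]
  unfold admOmega
  symm
  refine Finset.sum_image' _ fun τ hτ => ?_
  have hfib : (fun U => zeta D X av g₀ ε₀ ε₁ twoδ z (omegaOf D X τ) U V *
      (chiPrime (sect3Zero D X.bondsStar) av twoδ (omegaOf D X τ) U V *
        Real.exp (-(1 / g₀ ^ 2) * gaugeFixFn D.cd (X.sites1 (omegaOf D X τ)) U - (1 / g₀ ^ 2) * wilsonAction4 U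
          - ((P.L : ℝ) ^ 4 - 1) * ((X.sites1 (omegaOf D X τ)).card : ℝ) * Real.log z - E))) =
      fun U => ∑ σ ∈ (adm D X).filter (fun σ => omegaOf D X σ = omegaOf D X τ),
        zetaTerm D X av g₀ ε₀ ε₁ twoδ z σ U V * front D X av g₀ twoδ z E (omegaOf D X τ) U V := by
    funext U
    rw [zeta_eq, Finset.sum_mul]
    rfl
  rw [hfib, hTsum, Finset.mul_sum]
  refine Finset.sum_congr rfl fun σ hσ => ?_
  rw [Finset.mem_filter] at hσ
  rw [hterm σ hσ.1, hσ.2]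

/-- **(1.11) for the δ-function transformation of (0.1), push-forward reading.**  In the cell's reading `Setup.IsRT` of
`ρ₁(V) = ∫dU δ(ŪV⁻¹)ρ₀(U)` (`∫dV ρ₁(V)f(V) = ∫dU ρ₀(U)f(Ū)` for bounded measurable `f`; DIVERGENCE F7, the reading of rows
B14.Eq1.6 / B7.Eq10): under the hypotheses of p28's (1.6) `B14Eq16Proof.isRT_eq16` (gauge-covariant measurable averaging
`Ū = (av 0).avg U`, measurable `U_{1,□′}(·)` and `U(y,x)`, `g₀ ≠ 0`, `z := z(g₀², ε₀) ≠ 0` DEFINED by (1.5), `d = 4`, `1 ≤ m +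
K`), the (1.10) inclusions and the p. 248 drop sentence, if `ρ₁` is the renormalization image of `ρ₀` then `ρ₁` is the
renormalization image of the (1.11) density
`U ↦ Σ_{Ω₁} χ₁(Ω₁)(Ū) · ζ(Ω₁ᶜ)(U,Ū) χ′₀(Ω₁)(U,Ū) exp[−(1/g₀²)𝐆(Ω₁^{(1)},U) − (1/g₀²)A(U) − (L⁴−1)|Ω₁^{(1)}| log z − E]`
(the `V`-dependent factors evaluated at `V = Ū`, as `δ(ŪV⁻¹)` dictates).  PROOF = p28's (1.6) in this reading, (1.8) inserted
(`sum16_mul18`) and the resummation `resum`, pointwise in `U`. [cite: Balaban1988Convergent, (1.11) p.248] -/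
theorem isRT_eq111 [MeasurableSpace G] [HaarData G] [RegularGaugeGroup G] (hd : P.d = 4) (h01 : 0 + 1 ≤ P.m + P.K)
    (D : Sect1Data P G) (X : Geom D) (hX : X.Adm110 D) (av : ∀ j, Averaging P j G)
    (hav : Measurable (av 0).avg) (hU1 : ∀ c, Measurable (U1loc D c))
    (hcd : ∀ (y : Site P 1) (x : Site P 0), Measurable fun U : GaugeField P 0 G => D.cd.holTo U y x)
    {g₀ ε₀ : ℝ} (hg₀ : g₀ ≠ 0) (hz : B16ZLower.zNorm G (g₀ ^ 2) ε₀ ≠ 0) (ε₁ twoδ E : ℝ)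
    (hdrop : ∀ σ ∈ adm D X, ∀ (U : GaugeField P 0 G) (V : GaugeField P 1 G),
      chi1 D ε₁ (D.inCompl σ.1 \ σ.2.1) V ≠ 0 →
      chiPrime (sect3Zero D X.bondsStar) av twoδ (X.domQ σ.1 σ.2.1 \ σ.2.2) U V ≠ 0 →
      dropped D X ε₀ (omegaOf D X σ) U = 1)
    {ρ₁ : Density P 1 G} (hρ₁ : IsRT (av 0).avg (rho0 g₀ E) ρ₁) :
    IsRT (av 0).avg (fun U => ∑ Ω ∈ admOmega D X, chi1 D ε₁ Ω ((av 0).avg U) *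
      (zeta D X av g₀ ε₀ ε₁ twoδ (B16ZLower.zNorm G (g₀ ^ 2) ε₀) Ω U ((av 0).avg U) *
        (chiPrime (sect3Zero D X.bondsStar) av twoδ Ω U ((av 0).avg U) *
          Real.exp (-(1 / g₀ ^ 2) * gaugeFixFn D.cd (X.sites1 Ω) U - (1 / g₀ ^ 2) * wilsonAction4 U
            - ((P.L : ℝ) ^ 4 - 1) * ((X.sites1 Ω).card : ℝ) * Real.log (B16ZLower.zNorm G (g₀ ^ 2) ε₀) - E)))) ρ₁ := by
  have h16 := B14Eq16Proof.isRT_eq16 hd h01 D (av 0) hav hU1 hcd hg₀ hz ε₁ E hρ₁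
  have hF : (fun U => ∑ P0 ∈ (Finset.univ : Finset D.Cube0).powerset, ∑ P1 ∈ (D.inCompl P0).powerset,
      chi1c D ε₁ P1 ((av 0).avg U) * chi1 D ε₁ (D.inCompl P0 \ P1) ((av 0).avg U) *
        integrand16 D g₀ ε₀ (B16ZLower.zNorm G (g₀ ^ 2) ε₀) E P0 P1 U) =
      fun U => ∑ Ω ∈ admOmega D X, chi1 D ε₁ Ω ((av 0).avg U) *
        (zeta D X av g₀ ε₀ ε₁ twoδ (B16ZLower.zNorm G (g₀ ^ 2) ε₀) Ω U ((av 0).avg U) *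
          (chiPrime (sect3Zero D X.bondsStar) av twoδ Ω U ((av 0).avg U) *
            Real.exp (-(1 / g₀ ^ 2) * gaugeFixFn D.cd (X.sites1 Ω) U - (1 / g₀ ^ 2) * wilsonAction4 U
              - ((P.L : ℝ) ^ 4 - 1) * ((X.sites1 Ω).card : ℝ) * Real.log (B16ZLower.zNorm G (g₀ ^ 2) ε₀) - E))) := by
    funext U
    rw [sum16_mul18 D X av g₀ ε₀ ε₁ twoδ (B16ZLower.zNorm G (g₀ ^ 2) ε₀) E U ((av 0).avg U),
      resum D X av hX g₀ ε₀ ε₁ twoδ (B16ZLower.zNorm G (g₀ ^ 2) ε₀) E U ((av 0).avg U)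
        (fun σ hσ => hdrop σ hσ U ((av 0).avg U))]
    rfl
  rw [hF] at h16
  exact h16

end Eq111

end Literature.MathematicalPhysics.QuantumFieldTheory.Balaban1983to89.B14.Eq111Resummation
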